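import Mathlib.CategoryTheory.Galois.Basic
import Mathlib.CategoryTheory.Extensive
import Mathlib.CategoryTheory.Limits.Over
import Mathlib.CategoryTheory.Limits.Preserves.Shapes.Over
import Mathlib.CategoryTheory.Comma.Over.Pullback
import Literature.AnabelianGeometry.Anabelioids.GaloisFiniteColimits

/-!
# Exactness of slice functors in Galois categories ([SemiAnbd] Def. 2.2 (i), brick B2)

Mochizuki, *Semi-graphs of Anabelioids*, Publ. RIMS **42** (2006) 221–322, §2 p. 23
[cite: MochizukiSemiAnbd2006, Def. 2.2(i) p.23]; *The geometry of anabelioids*, Publ. RIMS **40**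
(2004), §1.1 p. 9 [cite: MochizukiGeoAn2004, §1.1 p.9] (the anabelioid `X_S := Over S` of an object
`S` and the pull-back morphisms between such).  For the finite étale covering `𝒢' → 𝒢` attached
to an object of `B(𝒢)` (Def. 2.2 (i)), the constituent of `𝒢'` at a component `P` of `S_v` is the
slice `(𝒢_v)_P = Over P`, and the gluing functor towards the constituent `Over Q` at a component
`Q` of `T_e` lying under `b^* P` is `X ↦ b^* X ×_{b^* P} Q`, i.e. `Over.post b^* ⋙ Over.pullback ι`
for the inclusion `ι : Q ↪ b^* P`.  A morphism of anabelioids must be an EXACT functor; this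
proof-only file supplies the exactness:

* `finitaryExtensive_of_galoisCategory` — a Galois category is finitary extensive (coproducts are
  disjoint and universal), transported from `Type` along the fibre functor;
* `preservesFiniteColimits_overPost` — `Over.post F` preserves finite colimits when `F` does (the
  limit half is Mathlib's `PreservesFiniteLimits.overPost`);
* `preservesFiniteColimits_overPullback_of_mono` — for a monomorphism `ι : Q ⟶ B` of a Galois
  category (a coproduct inclusion `B ≅ Q ⨿ Z` by axiom (G3)), `Over.pullback ι` preserves finite
  colimits: it is LEFT adjoint to `Y ↦ Y ⨿ Z` (over `Q ⨿ Z ≅ B`);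
* `exact_overPost_comp_overPullback` — the composite `Over.post F ⋙ Over.pullback ι` preserves
  finite limits and finite colimits.
-/

namespace Literature.AnabelianGeometry.Anabelioids

open CategoryTheory CategoryTheory.Limits CategoryTheory.PreGaloisCategory

universe w w' v₁ v₂ u₁ u₂

/-! ### Galois categories are extensive -/

/-- A Galois category is finitary extensive: binary coproducts are van Kampen (disjoint and stable
under pull-back) — transported from `Type` along a fibre functor, which preserves pull-backs and
finite coproducts and reflects isomorphisms. [cite: MochizukiGeoAn2004, §1.1 p.9] -/
theorem finitaryExtensive_of_galoisCategory (C : Type u₁) [Category.{v₁} C] [GaloisCategory C] :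
    FinitaryExtensive C := by
  let F := GaloisCategory.getFiberFunctor C
  haveI : PreservesLimitsOfShape WalkingCospan (F ⋙ FintypeCat.incl) := inferInstance
  haveI : PreservesColimitsOfShape (Discrete WalkingPair) (F ⋙ FintypeCat.incl) := inferInstance
  haveI : (F ⋙ FintypeCat.incl).ReflectsIsomorphisms := inferInstance
  exact finitaryExtensive_of_preserves_and_reflects_isomorphism (F ⋙ FintypeCat.incl)

/-! ### `Over.post` preserves finite colimits -/

/-- `Over.post F : Over X ⥤ Over (F X)` preserves the colimits of shape `J` that `F` preserves
(colimits in slices are computed in the base). [cite: MochizukiGeoAn2004, §1.1 p.9] -/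
theorem preservesColimitsOfShape_overPost {C : Type u₁} [Category.{v₁} C] {D : Type u₂}
    [Category.{v₂} D] (J : Type) [SmallCategory J] [HasColimitsOfShape J C] (F : C ⥤ D)
    [PreservesColimitsOfShape J F] (X : C) : PreservesColimitsOfShape J (Over.post F (X := X)) := by
  refine ⟨fun {K} => ⟨fun {c} hc => ⟨?_⟩⟩⟩
  -- the underlying cocone in `C` is a colimit, hence so is its image under `F`; colimits in
  -- `Over (F X)` are created by the forgetful functor
  have h1 : IsColimit ((Over.forget X).mapCocone c) := isColimitOfPreserves (Over.forget X) hc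
  have h2 : IsColimit (F.mapCocone ((Over.forget X).mapCocone c)) := isColimitOfPreserves F h1
  exact isColimitOfReflects (Over.forget (F.obj X)) h2

/-- `Over.post F` preserves finite colimits when `F` does (and the base has them).
[cite: MochizukiGeoAn2004, §1.1 p.9] -/
theorem preservesFiniteColimits_overPost {C : Type u₁} [Category.{v₁} C] {D : Type u₂}
    [Category.{v₂} D] [HasFiniteColimits C] (F : C ⥤ D) [PreservesFiniteColimits F] (X : C) :
    PreservesFiniteColimits (Over.post F (X := X)) :=
  ⟨fun J _ _ => preservesColimitsOfShape_overPost J F X⟩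

/-! ### Pull-back along a coproduct inclusion is a left adjoint -/

/-- In a finitary extensive category with pull-backs, pulling back along a coproduct inclusion
`ι : Q ⟶ Q ⨿ Z` preserves ALL colimits: `Over.pullback ι` is left adjoint to `Y ↦ Y ⨿ Z` (over
`Q ⨿ Z`), because an object `X → Q ⨿ Z` is the coproduct of its parts over `Q` and over `Z`, and
`Y ↪ Y ⨿ Z` is the pull-back of `Q ↪ Q ⨿ Z`. [cite: MochizukiGeoAn2004, §1.1 p.9] -/
theorem preservesColimitsOfSize_overPullback_inl {C : Type u₁} [Category.{v₁} C] [HasPullbacks C]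
    [FinitaryExtensive C] {Q Z : C} (c : BinaryCofan Q Z) (hc : IsColimit c) :
    PreservesColimitsOfSize.{w, w'} (Over.pullback c.inl) := by
  classical
  have hvk := FinitaryExtensive.vanKampen c hc
  -- clean names for the two inclusions
  let ι : Q ⟶ c.pt := c.inl
  let κ : Z ⟶ c.pt := c.inr
  -- (1) an object `X → Q ⨿ Z` is the coproduct of its parts over `Q` and over `Z`
  have hX : ∀ X : Over c.pt, Nonempty (IsColimit
      (BinaryCofan.mk (pullback.fst X.hom ι) (pullback.fst X.hom κ))) := fun X =>
    ((BinaryCofan.isVanKampen_iff c).mp hvk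
      (BinaryCofan.mk (pullback.fst X.hom ι) (pullback.fst X.hom κ))
      (pullback.snd X.hom ι) (pullback.snd X.hom κ) X.hom
      pullback.condition.symm pullback.condition.symm).mpr
      ⟨IsPullback.of_hasPullback X.hom ι, IsPullback.of_hasPullback X.hom κ⟩
  -- (2) for `Y → Q`, the summands of `Y ⨿ Z → Q ⨿ Z` are the pull-backs of those of `Q ⨿ Z`
  have hY : ∀ Y : Over Q,
      IsPullback (coprod.inl : Y.left ⟶ Y.left ⨿ Z) Y.hom (coprod.desc (Y.hom ≫ ι) κ) ι ∧
        IsPullback (coprod.inr : Z ⟶ Y.left ⨿ Z) (𝟙 Z) (coprod.desc (Y.hom ≫ ι) κ) κ := fun Y =>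
    ((BinaryCofan.isVanKampen_iff c).mp hvk
      (BinaryCofan.mk (coprod.inl : Y.left ⟶ Y.left ⨿ Z) coprod.inr) Y.hom (𝟙 Z)
      (coprod.desc (Y.hom ≫ ι) κ) (coprod.inl_desc _ _).symm
      (by rw [Category.id_comp]; exact (coprod.inr_desc _ _).symm)).mp ⟨coprodIsCoprod _ _⟩
  -- the structure equations of morphisms, in clean form
  have wQ : ∀ {Y Y' : Over Q} (g : Y ⟶ Y'), g.left ≫ Y'.hom = Y.hom := fun g => Over.w g
  have wP : ∀ {X : Over c.pt} {Y : Over Q} (g : (Over.pullback ι).obj X ⟶ Y),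
      g.left ≫ Y.hom = pullback.snd X.hom ι := fun g => Over.w g
  -- the right adjoint `Y ↦ Y ⨿ Z`
  let Φ : Over Q ⥤ Over c.pt :=
    { obj := fun Y => Over.mk (coprod.desc (Y.hom ≫ ι) κ)
      map := fun {Y Y'} g => Over.homMk (coprod.map g.left (𝟙 Z)) (by
        change coprod.map g.left (𝟙 Z) ≫ coprod.desc (Y'.hom ≫ ι) κ = coprod.desc (Y.hom ≫ ι) κ
        rw [coprod.map_desc, Category.id_comp, ← Category.assoc, wQ g])
      map_id := fun Y => by
        ext
        change coprod.map (𝟙 Y.left) (𝟙 Z) = 𝟙 (Y.left ⨿ Z)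
        exact coprod.map_id_id
      map_comp := fun {Y₁ Y₂ Y₃} g g' => by
        ext
        change coprod.map (g.left ≫ g'.left) (𝟙 Z) =
          coprod.map g.left (𝟙 Z) ≫ coprod.map g'.left (𝟙 Z)
        rw [coprod.map_map, Category.id_comp] }
  have wB : ∀ {X : Over c.pt} {Y : Over Q} (h : X ⟶ Φ.obj Y),
      h.left ≫ coprod.desc (Y.hom ≫ ι) κ = X.hom := fun h => Over.w h
  -- the forward map of the hom equivalence: `X = X_Q ⨿ X_Z → Y ⨿ Z`
  let fwd : ∀ (X : Over c.pt) (Y : Over Q), (pullback X.hom ι ⟶ Y.left) → (X.left ⟶ Y.left ⨿ Z) :=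
    fun X Y gl => (BinaryCofan.IsColimit.desc' (hX X).some (gl ≫ coprod.inl)
      (pullback.snd X.hom κ ≫ coprod.inr)).1
  have fwd_inl : ∀ (X : Over c.pt) (Y : Over Q) (gl : pullback X.hom ι ⟶ Y.left),
      pullback.fst X.hom ι ≫ fwd X Y gl = gl ≫ coprod.inl := fun X Y gl =>
    (BinaryCofan.IsColimit.desc' (hX X).some (gl ≫ coprod.inl)
      (pullback.snd X.hom κ ≫ coprod.inr)).2.1
  have fwd_inr : ∀ (X : Over c.pt) (Y : Over Q) (gl : pullback X.hom ι ⟶ Y.left),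
      pullback.fst X.hom κ ≫ fwd X Y gl = pullback.snd X.hom κ ≫ coprod.inr := fun X Y gl =>
    (BinaryCofan.IsColimit.desc' (hX X).some (gl ≫ coprod.inl)
      (pullback.snd X.hom κ ≫ coprod.inr)).2.2
  have fwd_w : ∀ (X : Over c.pt) (Y : Over Q) (gl : pullback X.hom ι ⟶ Y.left),
      gl ≫ Y.hom = pullback.snd X.hom ι → fwd X Y gl ≫ coprod.desc (Y.hom ≫ ι) κ = X.hom := by
    intro X Y gl hgl
    apply BinaryCofan.IsColimit.hom_ext (hX X).some
    · change pullback.fst X.hom ι ≫ fwd X Y gl ≫ coprod.desc (Y.hom ≫ ι) κ =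
        pullback.fst X.hom ι ≫ X.hom
      rw [← Category.assoc, fwd_inl, Category.assoc, coprod.inl_desc, ← Category.assoc, hgl]
      exact pullback.condition.symm
    · change pullback.fst X.hom κ ≫ fwd X Y gl ≫ coprod.desc (Y.hom ≫ ι) κ =
        pullback.fst X.hom κ ≫ X.hom
      rw [← Category.assoc, fwd_inr, Category.assoc, coprod.inr_desc]
      exact pullback.condition.symm
  -- functoriality of `fwd` in `Y`
  have fwd_map : ∀ (X : Over c.pt) (Y Y' : Over Q) (gl : pullback X.hom ι ⟶ Y.left)
      (m : Y.left ⟶ Y'.left),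
      fwd X Y' (gl ≫ m) = fwd X Y gl ≫ coprod.map m (𝟙 Z) := by
    intro X Y Y' gl m
    apply BinaryCofan.IsColimit.hom_ext (hX X).some
    · change pullback.fst X.hom ι ≫ fwd X Y' (gl ≫ m) =
        pullback.fst X.hom ι ≫ fwd X Y gl ≫ coprod.map m (𝟙 Z)
      rw [fwd_inl, ← Category.assoc, fwd_inl]
      simp only [Category.assoc, coprod.inl_map]
    · change pullback.fst X.hom κ ≫ fwd X Y' (gl ≫ m) =
        pullback.fst X.hom κ ≫ fwd X Y gl ≫ coprod.map m (𝟙 Z)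
      rw [fwd_inr, ← Category.assoc, fwd_inr]
      simp only [Category.assoc, coprod.inr_map, Category.id_comp]
  -- the backward map: restrict `X → Y ⨿ Z` to `X_Q → Y`
  have bwd_w : ∀ (X : Over c.pt) (Y : Over Q) (hl : X.left ⟶ Y.left ⨿ Z),
      hl ≫ coprod.desc (Y.hom ≫ ι) κ = X.hom →
      (pullback.fst X.hom ι ≫ hl) ≫ coprod.desc (Y.hom ≫ ι) κ = pullback.snd X.hom ι ≫ ι := by
    intro X Y hl w
    rw [Category.assoc, w]
    exact pullback.condition
  let bwd : ∀ (X : Over c.pt) (Y : Over Q) (hl : X.left ⟶ Y.left ⨿ Z),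
      hl ≫ coprod.desc (Y.hom ≫ ι) κ = X.hom → (pullback X.hom ι ⟶ Y.left) :=
    fun X Y hl w => (hY Y).1.lift (pullback.fst X.hom ι ≫ hl) (pullback.snd X.hom ι) (bwd_w X Y hl w)
  have bwd_inl : ∀ (X : Over c.pt) (Y : Over Q) (hl : X.left ⟶ Y.left ⨿ Z)
      (w : hl ≫ coprod.desc (Y.hom ≫ ι) κ = X.hom),
      bwd X Y hl w ≫ coprod.inl = pullback.fst X.hom ι ≫ hl := fun X Y hl w => (hY Y).1.lift_fst _ _ _
  have bwd_snd : ∀ (X : Over c.pt) (Y : Over Q) (hl : X.left ⟶ Y.left ⨿ Z)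
      (w : hl ≫ coprod.desc (Y.hom ≫ ι) κ = X.hom),
      bwd X Y hl w ≫ Y.hom = pullback.snd X.hom ι := fun X Y hl w => (hY Y).1.lift_snd _ _ _
  -- `bwd` and `fwd` are mutually inverse
  have bwd_fwd : ∀ (X : Over c.pt) (Y : Over Q) (gl : pullback X.hom ι ⟶ Y.left)
      (hgl : gl ≫ Y.hom = pullback.snd X.hom ι),
      bwd X Y (fwd X Y gl) (fwd_w X Y gl hgl) = gl := by
    intro X Y gl hgl
    apply (hY Y).1.hom_ext
    · rw [bwd_inl X Y _ (fwd_w X Y gl hgl), fwd_inl]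
    · rw [bwd_snd X Y _ (fwd_w X Y gl hgl), hgl]
  have fwd_bwd : ∀ (X : Over c.pt) (Y : Over Q) (hl : X.left ⟶ Y.left ⨿ Z)
      (w : hl ≫ coprod.desc (Y.hom ≫ ι) κ = X.hom),
      fwd X Y (bwd X Y hl w) = hl := by
    intro X Y hl w
    apply BinaryCofan.IsColimit.hom_ext (hX X).some
    · change pullback.fst X.hom ι ≫ fwd X Y _ = pullback.fst X.hom ι ≫ hl
      rw [fwd_inl, bwd_inl X Y hl w]
    · change pullback.fst X.hom κ ≫ fwd X Y _ = pullback.fst X.hom κ ≫ hl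
      rw [fwd_inr]
      -- a map into `Y ⨿ Z` over `κ` factors through `coprod.inr`
      have w' : (pullback.fst X.hom κ ≫ hl) ≫ coprod.desc (Y.hom ≫ ι) κ =
          pullback.snd X.hom κ ≫ κ := by
        rw [Category.assoc, w]
        exact pullback.condition
      have h1 := (hY Y).2.lift_fst _ _ w'
      have h2 := (hY Y).2.lift_snd _ _ w'
      rw [Category.comp_id] at h2
      rw [← h1, h2]
  -- naturality of `bwd` in `X`
  have bwd_map : ∀ (X' X : Over c.pt) (Y : Over Q) (fl : X'.left ⟶ X.left) (hf : fl ≫ X.hom = X'.hom)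
      (hl : X.left ⟶ Y.left ⨿ Z) (w : hl ≫ coprod.desc (Y.hom ≫ ι) κ = X.hom)
      (w' : (fl ≫ hl) ≫ coprod.desc (Y.hom ≫ ι) κ = X'.hom),
      bwd X' Y (fl ≫ hl) w' =
        pullback.lift (pullback.fst X'.hom ι ≫ fl) (pullback.snd X'.hom ι)
          (by rw [Category.assoc, hf]; exact pullback.condition) ≫ bwd X Y hl w := by
    intro X' X Y fl hf hl w w'
    apply (hY Y).1.hom_ext
    · rw [bwd_inl X' Y _ w', Category.assoc, bwd_inl X Y _ w, pullback.lift_fst_assoc, Category.assoc]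
    · rw [bwd_snd X' Y _ w', Category.assoc, bwd_snd X Y _ w, pullback.lift_snd]
  -- the hom equivalence
  let e : ∀ (X : Over c.pt) (Y : Over Q), ((Over.pullback ι).obj X ⟶ Y) ≃ (X ⟶ Φ.obj Y) :=
    fun X Y =>
    { toFun := fun g => Over.homMk (fwd X Y g.left) (fwd_w X Y g.left (wP g))
      invFun := fun h => Over.homMk (bwd X Y h.left (wB h)) (bwd_snd X Y h.left (wB h))
      left_inv := fun g => Over.OverMorphism.ext (bwd_fwd X Y g.left (wP g))
      right_inv := fun h => Over.OverMorphism.ext (fwd_bwd X Y h.left (wB h)) }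
  -- the adjunction `Over.pullback ι ⊣ Φ`
  let adj : Over.pullback ι ⊣ Φ := Adjunction.mkOfHomEquiv
    { homEquiv := e
      homEquiv_naturality_left_symm := by
        intro X' X Y f g
        apply Over.OverMorphism.ext
        exact bwd_map X' X Y f.left (Over.w f) g.left (wB g) (wB (f ≫ g))
      homEquiv_naturality_right := by
        intro X Y Y' f g
        apply Over.OverMorphism.ext
        exact fwd_map X Y Y' f.left g.left }
  exact adj.leftAdjoint_preservesColimits

/-! ### Galois categories: pull-back along a monomorphism -/

/-- In a Galois category, pulling back along a monomorphism `ι : Q ⟶ B` preserves all colimits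
(axiom (G3): `ι` is the inclusion of a direct summand, `B ≅ Q ⨿ Z`).
[cite: MochizukiGeoAn2004, §1.1 p.9] -/
theorem preservesColimitsOfSize_overPullback_of_mono {C : Type u₁} [Category.{v₁} C]
    [GaloisCategory C] {Q B : C} (ι : Q ⟶ B) [Mono ι] :
    PreservesColimitsOfSize.{w, w'} (Over.pullback ι) := by
  haveI := finitaryExtensive_of_galoisCategory C
  obtain ⟨Z, u, ⟨hc⟩⟩ := PreGaloisCategory.monoInducesIsoOnDirectSummand ι
  exact preservesColimitsOfSize_overPullback_inl (BinaryCofan.mk ι u) hc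

/-- In a Galois category, pulling back along a monomorphism preserves finite colimits.
[cite: MochizukiSemiAnbd2006, Def. 2.2(i) p.23] -/
theorem preservesFiniteColimits_overPullback_of_mono {C : Type u₁} [Category.{v₁} C]
    [GaloisCategory C] {Q B : C} (ι : Q ⟶ B) [Mono ι] :
    PreservesFiniteColimits (Over.pullback ι) := by
  haveI : PreservesColimitsOfSize.{0, 0} (Over.pullback ι) :=
    preservesColimitsOfSize_overPullback_of_mono ι
  exact PreservesColimitsOfSize.preservesFiniteColimits _

/-! ### The gluing functors of the covering semi-graph of anabelioids are exact -/

/-- **Brick B2 of [SemiAnbd] Def. 2.2 (i)**: for an exact functor `F : C ⥤ D` between Galois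
categories (a morphism of anabelioids `b^*`), an object `P` of `C` and a subobject
`ι : Q ↪ F P` (a component of `b^* P`), the functor `Over P ⥤ Over Q`, `X ↦ F X ×_{F P} Q` —
the gluing functor `(𝒢_v)_P → (𝒢_e)_Q` of the covering semi-graph of anabelioids — preserves
finite limits and finite colimits. [cite: MochizukiSemiAnbd2006, Def. 2.2(i) p.23] -/
theorem exact_overPost_comp_overPullback {C : Type u₁} [Category.{v₁} C] [GaloisCategory C]
    {D : Type u₂} [Category.{v₂} D] [GaloisCategory D] (F : C ⥤ D) [PreservesFiniteLimits F]
    [PreservesFiniteColimits F] (P : C) {Q : D} (ι : Q ⟶ F.obj P) [Mono ι] :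
    PreservesFiniteLimits (Over.post F ⋙ Over.pullback ι) ∧
      PreservesFiniteColimits (Over.post F ⋙ Over.pullback ι) := by
  haveI : HasFiniteColimits C := hasFiniteColimits_of_galoisCategory C
  haveI : PreservesFiniteColimits (Over.post F (X := P)) := preservesFiniteColimits_overPost F P
  haveI : PreservesFiniteColimits (Over.pullback ι) := preservesFiniteColimits_overPullback_of_mono ι
  haveI : PreservesLimitsOfSize.{0, 0} (Over.pullback ι) :=
    (Over.mapPullbackAdj ι).rightAdjoint_preservesLimits
  haveI : PreservesFiniteLimits (Over.pullback ι) := PreservesLimitsOfSize.preservesFiniteLimits _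
  exact ⟨comp_preservesFiniteLimits _ _, comp_preservesFiniteColimits _ _⟩

end Literature.AnabelianGeometry.Anabelioids
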